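import Mathlib
import Literature.AlgebraicGeometry.Resolution.WeightedInitialTerms
import HarnessLib

/-!
# Cutkosky 2009, Def. 10.10 / proof of Thm. 10.18: a point blow-up centred on the strict transform of an approximate hyperplane is a Tr1 or a Tr2 transformation (PROVED)

Topic: `Literature/AlgebraicGeometry/Resolution`.  S. D. Cutkosky, *Resolution of singularities for
3-folds in positive characteristic*, Amer. J. Math. **131** (2009) 59–127 [cite: Cutkosky2009],
Definition 10.10 (p. 31 l. 36–48 of the author version): the transformations

  Tr1: `x = x₁, y = x₁(y₁ + η), z = x₁ z₁` (`η ∈ k`),   Tr2: `x = x₁ y₁, y = y₁, z = y₁ z₁`,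

and the proof of Theorem 10.18, p. 37 l. 13–17: "Now suppose that `Sing_r(I_n) = V(x_n, y_n, z_n)`.
Then … `R_{n+1}` must be a Tr1 or Tr2 transformation of `R_n` by Lemma 5.1, since `V(z_n)` is an
approximate manifold of `I_n`."  Lemma 5.1 (2) places the next point `q` on the strict transform of
`V(z)` (tree: `NearPointHyperplane.lean`, `Cutkosky2009_L5_1_pointHyperplane`: `z ∈ (u 1, u 2) + 𝔪²`
for any presentation `(u, u')` of the chart at `q`); THIS file performs the remaining CHANGE OF
PRESENTATION: from an arbitrary presentation `φ(u 0) = u'_0`, `φ(u i) = u'_0 u'_i` (`i = 1, 2`) of the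
chart at `q` and good parameters `c = (z, x, y)` with `z ∈ (u 1, u 2) + 𝔪²`, it produces regular
parameters `c' = (z₁, x₁, y₁)` of the blown-up ring realising Tr1 (for some `η`, a unit or `0`)
or Tr2, with the same exceptional ideal `(x₁) = (u'_0)` resp. `(y₁) = (u'_0)` — so that the tree's
chart theorems (`PolygonChartTransport`, `PointBlowupPolygonLaws`, `PointStepPrepared`: hypotheses
`c'_1 = φ(c 1)`, `φ(c 0) = φ(c 1) c'_0`, `φ(c 2) = φ(c 1) c'_2`, weak transform `(J R' : φ(c 1)^μ)`)
apply to the system `(z, x, y − η x)` (Tr1) or, after the swap `x ↔ y`, to `(z, y, x)` (Tr2).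

## The argument (elementary linear algebra over a local ring; Cutkosky: "must be", no proof printed)

Write `c_i = Σ_j a_{ij} u_j` and `u_j = Σ_l b_{jl} c_l`.  Since a regular system of parameters of a
3-dimensional regular local ring is linearly independent modulo `𝔪²` (weighted quasi-regularity,
`coeff_mem_maximalIdeal_of_weval_mem_general` with weight `(1,1,1)`), `A B ≡ 1 (mod 𝔪)`, so `det A`
is a unit; `z ∈ (u 1, u 2) + 𝔪²` gives `a_{00} ∈ 𝔪`.  In `R'`, `φ(c_i) = u'_0 · w_i` with
`w_i = φ(a_{i0}) + φ(a_{i1}) u'_1 + φ(a_{i2}) u'_2 ≡ φ(a_{i0}) (mod 𝔪')`.  If `a_{10}` is a unit (Tr1):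
`x₁ = φ(x)`, `z₁ = w_z / w_x`, `η` a lift of the residue of `w_y / w_x`, `y₁ = w_y / w_x − φ(η)`; else
(Tr2) `a_{20}` is a unit and `y₁ = φ(y)`, `x₁ = w_x / w_y`, `z₁ = w_z / w_y`.  That `(z₁, x₁, y₁)`
generate `𝔪' = (u'_0, u'_1, u'_2)` is a `2 × 2` Cramer inversion whose determinant is
`∓ det A / a_{i0}` modulo `𝔪`.

## What is PROVED (theorems only; no definition, no fact)

* `mem_maximalIdeal_of_lin_mem_sq` — a regular system of parameters of a regular local ring of
  dimension `3` is linearly independent modulo `𝔪²`;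
* `exists_pointChart_presentation` — the Tr1 / Tr2 alternative above (general frame: `R` regular
  local of dimension `3`, `R'` local, `φ` a local homomorphism inducing a surjection of residue fields).

AI-written; weaker than expert review.

## Sources

* S. D. Cutkosky, Amer. J. Math. 131 (2009), Def. 10.10 p. 31 l. 36–48, p. 32 l. 1–7; proof of
  Thm. 10.18 p. 36 l. 84 – p. 37 l. 50; Lemma 5.1 (2) p. 17 l. 46–50. [Cutkosky2009]
* H. Matsumura, Commutative Ring Theory (1986), Thm. 17.10 (quasi-regularity) — via the tree's
  `WeightedQuasiRegularGeneral`. [Matsumura1987]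
-/

noncomputable section

open IsLocalRing MvPolynomial

namespace Literature.AlgebraicGeometry.Resolution

universe u

section LinIndep

variable {R : Type u} [CommRing R] [IsRegularLocalRing R] (c : Fin 3 → R)
  (hgen : Ideal.span {c 0, c 1, c 2} = maximalIdeal R) (hdim : ringKrullDim R = 3)

include hgen hdim in
/-- **A regular system of parameters is linearly independent modulo `𝔪²`**: if
`e₀ c₀ + e₁ c₁ + e₂ c₂ ∈ 𝔪²` then every `e_i ∈ 𝔪` (quasi-regularity in degree `1`).
[cite: Matsumura1987, Thm. 17.10] -/
theorem mem_maximalIdeal_of_lin_mem_sq (e : Fin 3 → R)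
    (h : e 0 * c 0 + e 1 * c 1 + e 2 * c 2 ∈ maximalIdeal R ^ 2) (i : Fin 3) :
    e i ∈ maximalIdeal R := by
  classical
  set F : MvPolynomial (Fin 3) R := ∑ j : Fin 3, monomial (Finsupp.single j 1) (e j) with hF
  have hsupp : ∀ m ∈ F.support, ∃ j : Fin 3, m = Finsupp.single j 1 := by
    intro m hm
    rw [hF] at hm
    obtain ⟨j, -, hj⟩ := Finset.mem_biUnion.mp (support_sum hm)
    exact ⟨j, by simpa using support_monomial_subset hj⟩
  have hFw : ∀ m ∈ F.support, Finsupp.weight (fun _ : Fin 3 => (1 : ℕ)) m = 1 := by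
    intro m hm
    obtain ⟨j, rfl⟩ := hsupp m hm
    simp [Finsupp.weight_apply, Finsupp.sum_single_index]
  have heval : eval c F = e 0 * c 0 + e 1 * c 1 + e 2 * c 2 := by
    rw [hF, map_sum, Fin.sum_univ_three]
    simp only [eval_monomial, Finsupp.prod_single_index, pow_zero, pow_one]
  have hmem : eval c F ∈ weightedIdealW c (fun _ : Fin 3 => (1 : ℕ)) (1 + 1) := by
    rw [heval, weightedIdealW_one_eq_pow c (span_range_eq_of_span_triple c hgen)]
    simpa using h
  have hcoeff : F.coeff (Finsupp.single i 1) = e i := by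
    rw [hF, coeff_sum, Fin.sum_univ_three]
    simp only [coeff_monomial, Finsupp.single_left_inj (one_ne_zero)]
    fin_cases i <;> simp
  rw [← hcoeff]
  exact coeff_mem_maximalIdeal_of_weval_mem_general c hgen hdim (fun _ => 1) (fun _ => Nat.one_pos)
    hFw hmem _

end LinIndep

section Present

variable {R R' : Type u} [CommRing R] [CommRing R'] [IsRegularLocalRing R] [IsLocalRing R']
  (φ : R →+* R') [IsLocalHom φ] {c u : Fin 3 → R} {u' : Fin 3 → R'}

omit [IsRegularLocalRing R] [IsLocalRing R'] in
/-- `2 × 2` Cramer inversion inside an ideal. [folklore] -/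
private theorem cramer₂ {S : Ideal R'} {m₁₁ m₁₂ m₂₁ m₂₂ v₁ v₂ : R'}
    (hdet : IsUnit (m₁₁ * m₂₂ - m₁₂ * m₂₁)) (h₁ : m₁₁ * v₁ + m₁₂ * v₂ ∈ S)
    (h₂ : m₂₁ * v₁ + m₂₂ * v₂ ∈ S) : v₁ ∈ S ∧ v₂ ∈ S := by
  obtain ⟨δ, hδ⟩ := hdet.exists_left_inv
  have e₁ : v₁ = δ * (m₂₂ * (m₁₁ * v₁ + m₁₂ * v₂) - m₁₂ * (m₂₁ * v₁ + m₂₂ * v₂)) := by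
    linear_combination (-v₁) * hδ
  have e₂ : v₂ = δ * (m₁₁ * (m₂₁ * v₁ + m₂₂ * v₂) - m₂₁ * (m₁₁ * v₁ + m₁₂ * v₂)) := by
    linear_combination (-v₂) * hδ
  refine ⟨?_, ?_⟩
  · rw [e₁]
    exact Ideal.mul_mem_left _ _
      (Ideal.sub_mem _ (Ideal.mul_mem_left _ _ h₁) (Ideal.mul_mem_left _ _ h₂))
  · rw [e₂]
    exact Ideal.mul_mem_left _ _
      (Ideal.sub_mem _ (Ideal.mul_mem_left _ _ h₂) (Ideal.mul_mem_left _ _ h₁))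

/-- **Cutkosky 2009, Def. 10.10 / proof of Thm. 10.18 («`R_{n+1}` must be a Tr1 or Tr2 transformation
of `R_n`»), PROVED.**  `R` regular local of dimension `3` with regular systems `c = (z, x, y)` (good
parameters) and `u`; `φ : R → R'` a local homomorphism onto-on-residue-fields presenting the origin of
the `u 0`-chart of the blow-up of the closed point (`𝔪' = (u'_0, u'_1, u'_2)`, `φ(u 0) = u'_0`,
`φ(u i) = u'_0 u'_i`); the centre lies on the strict transform of `V(z)`: `z ∈ (u 1, u 2) + 𝔪²`
(Lemma 5.1 (2), tree `Cutkosky2009_L5_1_pointHyperplane`).  THEN either (Tr1) for some `η ∈ R`, zero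
or a unit, there are regular parameters `c' = (z₁, x₁, y₁)` of `R'` with `x₁ = φ(x)`,
`φ(z) = x₁ z₁`, `φ(y − η x) = x₁ y₁` and `(x₁) = (u'_0)`; or (Tr2) there are regular parameters
`c' = (z₁, x₁, y₁)` with `y₁ = φ(y)`, `φ(z) = y₁ z₁`, `φ(x) = y₁ x₁` and `(y₁) = (u'_0)`.
[cite: Cutkosky2009, Def. 10.10, p. 31 l. 36–48; proof of Thm. 10.18, p. 37 l. 13–17] -/
theorem exists_pointChart_presentation
    (hgen : Ideal.span {c 0, c 1, c 2} = maximalIdeal R) (hdim : ringKrullDim R = 3)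
    (hu : Ideal.span {u 0, u 1, u 2} = maximalIdeal R)
    (hu' : Ideal.span {u' 0, u' 1, u' 2} = maximalIdeal R')
    (h0 : φ (u 0) = u' 0) (h1 : φ (u 1) = u' 0 * u' 1) (h2 : φ (u 2) = u' 0 * u' 2)
    (hψ : Function.Surjective (ResidueField.map φ))
    (hz : c 0 ∈ Ideal.span {u 1, u 2} ⊔ maximalIdeal R ^ 2) :
    (∃ η : R, (η = 0 ∨ IsUnit η) ∧ ∃ c' : Fin 3 → R',
        Ideal.span {c' 0, c' 1, c' 2} = maximalIdeal R' ∧ Ideal.span {c' 1} = Ideal.span {u' 0} ∧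
        c' 1 = φ (c 1) ∧ φ (c 0) = φ (c 1) * c' 0 ∧ φ (c 2 - η * c 1) = φ (c 1) * c' 2) ∨
    (∃ c' : Fin 3 → R',
        Ideal.span {c' 0, c' 1, c' 2} = maximalIdeal R' ∧ Ideal.span {c' 2} = Ideal.span {u' 0} ∧
        c' 2 = φ (c 2) ∧ φ (c 0) = φ (c 2) * c' 0 ∧ φ (c 1) = φ (c 2) * c' 1) := by
  classical
  have hci : ∀ i, c i ∈ maximalIdeal R := fun i => by
    rw [← hgen]; exact Ideal.subset_span (by fin_cases i <;> simp)
  have hui : ∀ i, u i ∈ maximalIdeal R := fun i => by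
    rw [← hu]; exact Ideal.subset_span (by fin_cases i <;> simp)
  have hu'i : ∀ i, u' i ∈ maximalIdeal R' := fun i => by
    rw [← hu']; exact Ideal.subset_span (by fin_cases i <;> simp)
  -- `φ(𝔪) ⊆ (u'_0)`
  have hmap𝔪 : ∀ r ∈ maximalIdeal R, φ r ∈ Ideal.span {u' 0} := by
    intro r hr
    have hr' : r ∈ Ideal.span ({u 0, u 1, u 2} : Set R) := by rw [hu]; exact hr
    have := Ideal.mem_map_of_mem φ hr'
    rw [Ideal.map_span] at this
    refine (Ideal.span_le.mpr ?_) this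
    rintro _ ⟨v, hv, rfl⟩
    simp only [Set.mem_insert_iff, Set.mem_singleton_iff] at hv
    rcases hv with rfl | rfl | rfl
    · rw [h0]; exact Ideal.mem_span_singleton_self _
    · rw [h1]; exact Ideal.mul_mem_right _ _ (Ideal.mem_span_singleton_self _)
    · rw [h2]; exact Ideal.mul_mem_right _ _ (Ideal.mem_span_singleton_self _)
  -- coefficient matrices `c = A u`, `u = B c`
  have hA : ∀ i, ∃ a : Fin 3 → R, a 0 * u 0 + a 1 * u 1 + a 2 * u 2 = c i := fun i => by
    have : c i ∈ Ideal.span ({u 0, u 1, u 2} : Set R) := by rw [hu]; exact hci i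
    obtain ⟨p, q, r, h⟩ := Submodule.mem_span_triple.mp this
    exact ⟨![p, q, r], by simpa [smul_eq_mul] using h⟩
  choose a ha using hA
  have hB : ∀ j, ∃ b : Fin 3 → R, b 0 * c 0 + b 1 * c 1 + b 2 * c 2 = u j := fun j => by
    have : u j ∈ Ideal.span ({c 0, c 1, c 2} : Set R) := by rw [hgen]; exact hui j
    obtain ⟨p, q, r, h⟩ := Submodule.mem_span_triple.mp this
    exact ⟨![p, q, r], by simpa [smul_eq_mul] using h⟩
  choose b hb using hB
  -- `a 0 0 ∈ 𝔪` from `z ∈ (u 1, u 2) + 𝔪²`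
  have ha00 : a 0 0 ∈ maximalIdeal R := by
    obtain ⟨s, hs, m, hm, hsm⟩ := Submodule.mem_sup.mp hz
    obtain ⟨p, q, hpq⟩ := Ideal.mem_span_pair.mp hs
    have hlin : a 0 0 * u 0 + (a 0 1 - p) * u 1 + (a 0 2 - q) * u 2 = m := by
      have := ha 0; rw [← hsm, ← hpq] at this; linear_combination this
    have := mem_maximalIdeal_of_lin_mem_sq u hu hdim ![a 0 0, a 0 1 - p, a 0 2 - q]
      (by simpa [hlin] using hm) 0
    simpa using this
  -- `A B ≡ 1 (mod 𝔪)`, hence `det A` is a unit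
  set A : Matrix (Fin 3) (Fin 3) R := Matrix.of fun i j => a i j with hAdef
  set B : Matrix (Fin 3) (Fin 3) R := Matrix.of fun j l => b j l with hBdef
  have hABi : ∀ i l, (A * B) i l = a i 0 * b 0 l + a i 1 * b 1 l + a i 2 * b 2 l := fun i l => by
    rw [Matrix.mul_apply, Fin.sum_univ_three]; rfl
  have hAB : ∀ i l, (A * B) i l - (1 : Matrix (Fin 3) (Fin 3) R) i l ∈ maximalIdeal R := by
    intro i l
    have hi := ha i
    rw [← hb 0, ← hb 1, ← hb 2] at hi
    have key : ((A * B) i 0 - (1 : Matrix (Fin 3) (Fin 3) R) i 0) * c 0 +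
        ((A * B) i 1 - (1 : Matrix (Fin 3) (Fin 3) R) i 1) * c 1 +
        ((A * B) i 2 - (1 : Matrix (Fin 3) (Fin 3) R) i 2) * c 2 = 0 := by
      simp only [hABi, Matrix.one_apply]
      fin_cases i <;> simp at hi ⊢ <;> linear_combination hi
    have := mem_maximalIdeal_of_lin_mem_sq c hgen hdim
      (fun l => (A * B) i l - (1 : Matrix (Fin 3) (Fin 3) R) i l) (by rw [key]; exact zero_mem _) l
    exact this
  have hdetA : IsUnit A.det := by
    rw [← residue_ne_zero_iff_isUnit]
    intro h0A
    have hmat : (residue R).mapMatrix (A * B) = 1 := by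
      ext i l
      rw [RingHom.mapMatrix_apply, Matrix.map_apply]
      have := hAB i l
      rw [← residue_eq_zero_iff, map_sub, sub_eq_zero] at this
      rw [this, Matrix.one_apply, Matrix.one_apply]
      split_ifs <;> simp
    have := congrArg Matrix.det hmat
    rw [Matrix.det_one, ← RingHom.map_det, Matrix.det_mul, map_mul, h0A, zero_mul] at this
    exact zero_ne_one this
  have hdetA' : A.det = a 0 0 * (a 1 1 * a 2 2 - a 1 2 * a 2 1) - a 0 1 * (a 1 0 * a 2 2 - a 1 2 * a 2 0)
      + a 0 2 * (a 1 0 * a 2 1 - a 1 1 * a 2 0) := by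
    rw [Matrix.det_fin_three]; simp only [hAdef, Matrix.of_apply]; ring
  -- the images `φ(c_i) = u'_0 · w_i`
  set w : Fin 3 → R' := fun i => φ (a i 0) + φ (a i 1) * u' 1 + φ (a i 2) * u' 2 with hw
  have hφc : ∀ i, φ (c i) = u' 0 * w i := fun i => by
    rw [← ha i]; simp only [map_add, map_mul, h0, h1, h2, hw]; ring
  have hwsub : ∀ i, w i - φ (a i 0) = φ (a i 1) * u' 1 + φ (a i 2) * u' 2 := fun i => by
    simp only [hw]; ring
  have hw𝔪 : ∀ i, w i - φ (a i 0) ∈ maximalIdeal R' := fun i => by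
    rw [hwsub]
    exact add_mem (Ideal.mul_mem_left _ _ (hu'i 1)) (Ideal.mul_mem_left _ _ (hu'i 2))
  have hwU : ∀ i, IsUnit (a i 0) → IsUnit (w i) := fun i hai => by
    have := isUnit_add_of_mem_maximalIdeal (hai.map φ) (hw𝔪 i)
    simpa using this
  have hw𝔪' : ∀ i, a i 0 ∈ maximalIdeal R → w i ∈ maximalIdeal R' := fun i hai => by
    have := add_mem (map_nonunit φ _ hai) (hw𝔪 i)
    simpa using this
  have hwres : ∀ i, residue R' (w i) = residue R' (φ (a i 0)) := fun i => by
    rw [← sub_eq_zero, ← map_sub, residue_eq_zero_iff]; exact hw𝔪 i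
  -- an element of `R` whose image lies in `𝔪'` lies in `𝔪`
  have hpull : ∀ r : R, φ r ∈ maximalIdeal R' → r ∈ maximalIdeal R := fun r hr => by
    by_contra hru
    exact hr ((notMem_maximalIdeal.mp hru).map φ)
  by_cases h10 : IsUnit (a 1 0)
  · ---------------------------------------------------------------- Tr1
    have hwx := hwU 1 h10
    obtain ⟨ι, hι⟩ := hwx.exists_left_inv
    -- lift the residue of `t = w_y / w_x`
    obtain ⟨η₀, hη₀⟩ : ∃ η₀ : R, ι * w 2 - φ η₀ ∈ maximalIdeal R' := by
      obtain ⟨ρ, hρ⟩ := hψ (residue R' (ι * w 2))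
      obtain ⟨η₀, rfl⟩ := residue_surjective ρ
      refine ⟨η₀, ?_⟩
      rw [← residue_eq_zero_iff, map_sub, ← hρ, ResidueField.map_residue, sub_self]
    obtain ⟨η, hη, hηt⟩ : ∃ η : R, (η = 0 ∨ IsUnit η) ∧ ι * w 2 - φ η ∈ maximalIdeal R' := by
      by_cases hηu : IsUnit η₀
      · exact ⟨η₀, Or.inr hηu, hη₀⟩
      · refine ⟨0, Or.inl rfl, ?_⟩
        have hη𝔪 : φ η₀ ∈ maximalIdeal R' :=
          map_nonunit φ η₀ ((mem_maximalIdeal _).mpr hηu)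
        have := add_mem hη₀ hη𝔪
        simpa using this
    -- `a 2 0 − η a 1 0 ∈ 𝔪`
    have hηres : residue R' (φ η) * residue R' (φ (a 1 0)) = residue R' (φ (a 2 0)) := by
      have h1' : residue R' (φ η) = residue R' ι * residue R' (w 2) := by
        rw [← map_mul, ← sub_eq_zero, ← map_sub, residue_eq_zero_iff]
        have := Submodule.neg_mem _ hηt
        simpa using this
      have h2' : residue R' ι * residue R' (w 1) = 1 := by rw [← map_mul, hι, map_one]
      rw [h1', hwres 2, ← hwres 1, mul_comm (residue R' ι), mul_assoc, h2', mul_one]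
    have h20 : a 2 0 - η * a 1 0 ∈ maximalIdeal R := by
      apply hpull
      rw [← residue_eq_zero_iff, map_sub, map_mul, map_sub, map_mul, hηres, sub_self]
    -- the new parameters
    refine Or.inl ⟨η, hη, ![ι * w 0, φ (c 1), ι * w 2 - φ η], ?_, ?_, by simp, ?_, ?_⟩
    · -- regular system
      show Ideal.span {ι * w 0, φ (c 1), ι * w 2 - φ η} = maximalIdeal R'
      apply le_antisymm
      · rw [Ideal.span_le]
        rintro v hv
        simp only [Set.mem_insert_iff, Set.mem_singleton_iff] at hv
        rcases hv with rfl | rfl | rfl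
        · exact Ideal.mul_mem_left _ _ (hw𝔪' 0 ha00)
        · exact map_nonunit φ _ (hci 1)
        · exact hηt
      · -- `u'_0, u'_1, u'_2` lie in the span
        set S : Ideal R' := Ideal.span {ι * w 0, φ (c 1), ι * w 2 - φ η} with hS
        have hx₁S : φ (c 1) ∈ S := Ideal.subset_span (by simp)
        have hz₁S : ι * w 0 ∈ S := Ideal.subset_span (by simp)
        have hy₁S : ι * w 2 - φ η ∈ S := Ideal.subset_span (by simp)
        have hu0S : u' 0 ∈ S := by
          have : u' 0 = ι * φ (c 1) := by rw [hφc 1]; linear_combination (-(u' 0)) * hι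
          rw [this]; exact Ideal.mul_mem_left _ _ hx₁S
        have hspan0 : Ideal.span {u' 0} ≤ S := by
          rw [Ideal.span_le, Set.singleton_subset_iff]; exact hu0S
        -- the two rows
        have hrow1 : φ (a 0 1) * u' 1 + φ (a 0 2) * u' 2 ∈ S := by
          have : φ (a 0 1) * u' 1 + φ (a 0 2) * u' 2 = w 1 * (ι * w 0) - φ (a 0 0) := by
            rw [← hwsub 0]; linear_combination (-(w 0)) * hι
          rw [this]
          exact Ideal.sub_mem _ (Ideal.mul_mem_left _ _ hz₁S) (hspan0 (hmap𝔪 _ ha00))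
        have hrow2 : (φ (a 2 1) - φ η * φ (a 1 1)) * u' 1 + (φ (a 2 2) - φ η * φ (a 1 2)) * u' 2
            ∈ S := by
          have : (φ (a 2 1) - φ η * φ (a 1 1)) * u' 1 + (φ (a 2 2) - φ η * φ (a 1 2)) * u' 2 =
              w 1 * (ι * w 2 - φ η) - φ (a 2 0 - η * a 1 0) := by
            rw [map_sub, map_mul]
            have e2 := hwsub 2
            have e1 := hwsub 1
            linear_combination (-(w 2)) * hι + e2 - (φ η) * e1
          rw [this]
          exact Ideal.sub_mem _ (Ideal.mul_mem_left _ _ hy₁S) (hspan0 (hmap𝔪 _ h20))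
        -- its determinant is a unit
        have hdet : IsUnit (φ (a 0 1) * (φ (a 2 2) - φ η * φ (a 1 2)) -
            φ (a 0 2) * (φ (a 2 1) - φ η * φ (a 1 1))) := by
          have hdR : IsUnit (a 0 1 * (a 2 2 - η * a 1 2) - a 0 2 * (a 2 1 - η * a 1 1)) := by
            have hid : a 1 0 * (a 0 1 * (a 2 2 - η * a 1 2) - a 0 2 * (a 2 1 - η * a 1 1)) =
                -A.det + a 0 0 * (a 1 1 * a 2 2 - a 1 2 * a 2 1)
                  - (a 2 0 - η * a 1 0) * (a 0 2 * a 1 1 - a 0 1 * a 1 2) := by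
              rw [hdetA']; ring
            rw [← residue_ne_zero_iff_isUnit]
            intro hzero
            have := congrArg (residue R) hid
            rw [map_mul, hzero, mul_zero, map_sub, map_add, map_mul (residue R) (a 0 0),
              (residue_eq_zero_iff _).mpr ha00, zero_mul, add_zero, map_mul (residue R) (a 2 0 - _),
              (residue_eq_zero_iff _).mpr h20, zero_mul, sub_zero, map_neg] at this
            exact (residue_ne_zero_iff_isUnit _).mpr hdetA (neg_eq_zero.mp this.symm)
          have := hdR.map φ
          simpa [map_sub, map_mul] using this
        obtain ⟨hu1S, hu2S⟩ := cramer₂ hdet hrow1 hrow2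
        rw [← hu', Ideal.span_le]
        rintro v hv
        simp only [Set.mem_insert_iff, Set.mem_singleton_iff] at hv
        rcases hv with rfl | rfl | rfl
        · exact hu0S
        · exact hu1S
        · exact hu2S
    · -- exceptional ideal
      show Ideal.span {φ (c 1)} = Ideal.span {u' 0}
      rw [hφc 1]; exact Ideal.span_singleton_mul_right_unit hwx _
    · show φ (c 0) = φ (c 1) * (ι * w 0)
      rw [hφc 0, hφc 1]; linear_combination (-(u' 0 * w 0)) * hι
    · show φ (c 2 - η * c 1) = φ (c 1) * (ι * w 2 - φ η)
      rw [map_sub, map_mul, hφc 2, hφc 1]; linear_combination (-(u' 0 * w 2)) * hι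
  · ---------------------------------------------------------------- Tr2
    have ha10 : a 1 0 ∈ maximalIdeal R := (mem_maximalIdeal _).mpr h10
    have h20 : IsUnit (a 2 0) := by
      by_contra h20
      have ha20 : a 2 0 ∈ maximalIdeal R := (mem_maximalIdeal _).mpr h20
      apply (notMem_maximalIdeal.mpr hdetA)
      rw [hdetA']
      refine add_mem (Ideal.sub_mem _ (Ideal.mul_mem_right _ _ ha00) (Ideal.mul_mem_left _ _ ?_))
        (Ideal.mul_mem_left _ _ ?_)
      · exact Ideal.sub_mem _ (Ideal.mul_mem_right _ _ ha10) (Ideal.mul_mem_left _ _ ha20)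
      · exact Ideal.sub_mem _ (Ideal.mul_mem_right _ _ ha10) (Ideal.mul_mem_left _ _ ha20)
    have hwy := hwU 2 h20
    obtain ⟨ι, hι⟩ := hwy.exists_left_inv
    refine Or.inr ⟨![ι * w 0, ι * w 1, φ (c 2)], ?_, ?_, by simp, ?_, ?_⟩
    · show Ideal.span {ι * w 0, ι * w 1, φ (c 2)} = maximalIdeal R'
      apply le_antisymm
      · rw [Ideal.span_le]
        rintro v hv
        simp only [Set.mem_insert_iff, Set.mem_singleton_iff] at hv
        rcases hv with rfl | rfl | rfl
        · exact Ideal.mul_mem_left _ _ (hw𝔪' 0 ha00)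
        · exact Ideal.mul_mem_left _ _ (hw𝔪' 1 ha10)
        · exact map_nonunit φ _ (hci 2)
      · set S : Ideal R' := Ideal.span {ι * w 0, ι * w 1, φ (c 2)} with hS
        have hy₁S : φ (c 2) ∈ S := Ideal.subset_span (by simp)
        have hz₁S : ι * w 0 ∈ S := Ideal.subset_span (by simp)
        have hx₁S : ι * w 1 ∈ S := Ideal.subset_span (by simp)
        have hu0S : u' 0 ∈ S := by
          have : u' 0 = ι * φ (c 2) := by rw [hφc 2]; linear_combination (-(u' 0)) * hι
          rw [this]; exact Ideal.mul_mem_left _ _ hy₁S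
        have hspan0 : Ideal.span {u' 0} ≤ S := by
          rw [Ideal.span_le, Set.singleton_subset_iff]; exact hu0S
        have hrow1 : φ (a 0 1) * u' 1 + φ (a 0 2) * u' 2 ∈ S := by
          have : φ (a 0 1) * u' 1 + φ (a 0 2) * u' 2 = w 2 * (ι * w 0) - φ (a 0 0) := by
            rw [← hwsub 0]; linear_combination (-(w 0)) * hι
          rw [this]
          exact Ideal.sub_mem _ (Ideal.mul_mem_left _ _ hz₁S) (hspan0 (hmap𝔪 _ ha00))
        have hrow2 : φ (a 1 1) * u' 1 + φ (a 1 2) * u' 2 ∈ S := by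
          have : φ (a 1 1) * u' 1 + φ (a 1 2) * u' 2 = w 2 * (ι * w 1) - φ (a 1 0) := by
            rw [← hwsub 1]; linear_combination (-(w 1)) * hι
          rw [this]
          exact Ideal.sub_mem _ (Ideal.mul_mem_left _ _ hx₁S) (hspan0 (hmap𝔪 _ ha10))
        have hdet : IsUnit (φ (a 0 1) * φ (a 1 2) - φ (a 0 2) * φ (a 1 1)) := by
          have hdR : IsUnit (a 0 1 * a 1 2 - a 0 2 * a 1 1) := by
            have hid : a 2 0 * (a 0 1 * a 1 2 - a 0 2 * a 1 1) =
                A.det - a 0 0 * (a 1 1 * a 2 2 - a 1 2 * a 2 1)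
                  + a 1 0 * (a 0 1 * a 2 2 - a 0 2 * a 2 1) := by
              rw [hdetA']; ring
            rw [← residue_ne_zero_iff_isUnit]
            intro hzero
            have := congrArg (residue R) hid
            rw [map_mul, hzero, mul_zero, map_add, map_sub, map_mul (residue R) (a 0 0),
              (residue_eq_zero_iff _).mpr ha00, zero_mul, sub_zero, map_mul (residue R) (a 1 0),
              (residue_eq_zero_iff _).mpr ha10, zero_mul, add_zero] at this
            exact (residue_ne_zero_iff_isUnit _).mpr hdetA this.symm
          have := hdR.map φ
          simpa [map_sub, map_mul] using this
        obtain ⟨hu1S, hu2S⟩ := cramer₂ hdet hrow1 hrow2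
        rw [← hu', Ideal.span_le]
        rintro v hv
        simp only [Set.mem_insert_iff, Set.mem_singleton_iff] at hv
        rcases hv with rfl | rfl | rfl
        · exact hu0S
        · exact hu1S
        · exact hu2S
    · show Ideal.span {φ (c 2)} = Ideal.span {u' 0}
      rw [hφc 2]; exact Ideal.span_singleton_mul_right_unit hwy _
    · show φ (c 0) = φ (c 2) * (ι * w 0)
      rw [hφc 0, hφc 2]; linear_combination (-(u' 0 * w 0)) * hι
    · show φ (c 1) = φ (c 2) * (ι * w 1)
      rw [hφc 1, hφc 2]; linear_combination (-(u' 0 * w 1)) * hι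

end Present

end Literature.AlgebraicGeometry.Resolution
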